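import Summits.ResolutionOfSingularities.ResolutionOfSingularities.Theorems.RisoStrataRtdLocal

/-!
# Crux `RisoCentresResolve` (stmt-ResolutionOfSingularities-18546), line `Sketch`

Stub `rtd_adjoin_arcEquiv`: the algebra half of the PRODUCT lemma
`Rtd B m r → Rtd B[u] m' (r + 1)`, namely the arc bijection along the adjunction of an
indeterminate.

Setting: `B ⊆ K` a `k`-subalgebra of a field, `u : K` transcendental over `B` (the evaluation
`Polynomial.aeval u : B[X] → K` has trivial kernel), `B' := Algebra.adjoin k (B ∪ {u}) = B[u]`,
`incl : B →ₐ[k] B'` the inclusion, `U = u` as an element of `B'`, `c₀ : k`, and an ideal `m'` of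
`B'` contracting to the ideal `m` of `B` and containing `U - c₀`; finally `B` admits a finite
presentation inside `m` (so arcs centred at `m` have nonnegative order on all of `B`).  An *arc*
is a `k`-algebra map to the Hahn field `k⟦t^ℚ⟧ = HahnSeries ℚ k` sending the ideal to series of
positive order.

Claim: the arcs of `B'` centred at `m'` correspond bijectively to the pairs
(arc of `B` centred at `m`, Hahn series `σ` of positive order), via
`α' ↦ (α' ∘ incl, α' (U - c₀))`.

Proof.  `Φ := Polynomial.aevalTower incl U : B[X] →ₐ[k] B'` is injective (composed with the
injection `B' ⊆ K` it is `Polynomial.aeval u`) and surjective (its image in `K` is a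
`k`-subalgebra containing `B` and `u`), so `e : B[X] ≃ₐ[k] B'` with `e (C b) = incl b`, `e X = U`.
Hence `k`-algebra maps out of `B'` are determined by, and freely prescribed on, `incl B` and `U`:
the inverse sends `(α, σ)` to the extension `ψ` of `α` with `ψ U = C c₀ + σ`.  It is centred at
`m'`: every `z ∈ B'` is `incl b₀ + (U - c₀) * z₁` (divide the polynomial by `X - C c₀`), and
`z ∈ m' ↔ b₀ ∈ m`; then `ψ z = α b₀ + σ * ψ z₁` has positive order because `ψ` is nonnegative on
`B'` (it is so on `incl B` by `sqdom_orderTop_nonneg` and on `U`).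
-/

set_option linter.dupNamespace false -- mandated namespace of this single-conjunct summit

namespace Summit.ResolutionOfSingularities.ResolutionOfSingularities.Theorems

section AdjoinArcEquivHelpers

variable {k K : Type} [Field k] [Field K] [Algebra k K]

/-- `B[X] ≃ₐ[k] B[u]` for `u` transcendental over `B ⊆ K`: the evaluation `C b ↦ b`, `X ↦ u`
is a `k`-algebra isomorphism onto `Algebra.adjoin k (B ∪ {u})`. -/
theorem adjArc_exists_algEquiv (B : Subalgebra k K) (u : K)
    (hu : ∀ q : Polynomial ↥B, Polynomial.aeval u q = 0 → q = 0)
    (hle : B ≤ Algebra.adjoin k ((B : Set K) ∪ {u}))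
    (U : ↥(Algebra.adjoin k ((B : Set K) ∪ {u}))) (hU : (U : K) = u) :
    ∃ e : Polynomial ↥B ≃ₐ[k] ↥(Algebra.adjoin k ((B : Set K) ∪ {u})),
      (∀ b, e (Polynomial.C b) = Subalgebra.inclusion hle b) ∧ e Polynomial.X = U := by
  obtain ⟨Φ, hΦC, hΦX⟩ :
      ∃ Φ : Polynomial ↥B →ₐ[k] ↥(Algebra.adjoin k ((B : Set K) ∪ {u})),
        (∀ b, Φ (Polynomial.C b) = Subalgebra.inclusion hle b) ∧ Φ Polynomial.X = U :=
    ⟨Polynomial.aevalTower (Subalgebra.inclusion hle) U,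
      fun b => Polynomial.aevalTower_C _ _ b, Polynomial.aevalTower_X _ _⟩
  -- composed with `B' ⊆ K`, `Φ` is the evaluation at `u`
  have hval : ∀ q, (Φ q : K) = Polynomial.aeval u q := by
    have h : (Subalgebra.val _).toRingHom.comp Φ.toRingHom =
        (Polynomial.aeval u : Polynomial ↥B →ₐ[↥B] K).toRingHom := by
      refine Polynomial.ringHom_ext (fun a => ?_) ?_
      · simp [hΦC]
      · simp [hΦX, hU]
    intro q
    exact RingHom.congr_fun h q
  have hinj : Function.Injective Φ := by
    intro p q hpq
    rw [← sub_eq_zero]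
    apply hu
    rw [map_sub, ← hval, ← hval, hpq, sub_self]
  have hsurj : Function.Surjective Φ := by
    intro z
    have hrange : Algebra.adjoin k ((B : Set K) ∪ {u}) ≤
        ((Subalgebra.val _).comp Φ).range := by
      rw [Algebra.adjoin_le_iff]
      rintro y (hy | hy)
      · exact ⟨Polynomial.C ⟨y, hy⟩, by simp [hΦC]⟩
      · rw [Set.mem_singleton_iff] at hy
        subst hy
        exact ⟨Polynomial.X, by simp [hΦX, hU]⟩
    obtain ⟨q, hq⟩ := hrange z.2
    exact ⟨q, Subtype.ext hq⟩
  refine ⟨AlgEquiv.ofBijective Φ ⟨hinj, hsurj⟩, fun b => ?_, ?_⟩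
  · rw [AlgEquiv.ofBijective_apply, hΦC]
  · rw [AlgEquiv.ofBijective_apply, hΦX]

/-- Division by `X - C c₀` transported to `B[u]`: every element is `incl b₀ + (U - c₀) * z₁`. -/
theorem adjArc_decomp (B : Subalgebra k K) (u : K)
    (hu : ∀ q : Polynomial ↥B, Polynomial.aeval u q = 0 → q = 0)
    (hle : B ≤ Algebra.adjoin k ((B : Set K) ∪ {u}))
    (U : ↥(Algebra.adjoin k ((B : Set K) ∪ {u}))) (hU : (U : K) = u) (c₀ : k)
    (z : ↥(Algebra.adjoin k ((B : Set K) ∪ {u}))) :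
    ∃ (b₀ : ↥B) (z₁ : ↥(Algebra.adjoin k ((B : Set K) ∪ {u}))),
      z = Subalgebra.inclusion hle b₀ +
        (U - algebraMap k ↥(Algebra.adjoin k ((B : Set K) ∪ {u})) c₀) * z₁ := by
  obtain ⟨e, heC, heX⟩ := adjArc_exists_algEquiv B u hu hle U hU
  obtain ⟨q, rfl⟩ := e.surjective z
  refine ⟨q.eval (algebraMap k ↥B c₀),
    e (q /ₘ (Polynomial.X - Polynomial.C (algebraMap k ↥B c₀))), ?_⟩
  conv_lhs =>
    rw [← Polynomial.modByMonic_add_div q (Polynomial.X - Polynomial.C (algebraMap k ↥B c₀)),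
      Polynomial.modByMonic_X_sub_C_eq_C_eval]
  rw [map_add, map_mul, map_sub, heC, heX, heC, AlgHom.commutes]

/-- Free prescription: a `k`-algebra map `α` out of `B` and a value `x` for `U` extend to a
`k`-algebra map out of `B[u]`. -/
theorem adjArc_exists_ext (B : Subalgebra k K) (u : K)
    (hu : ∀ q : Polynomial ↥B, Polynomial.aeval u q = 0 → q = 0)
    (hle : B ≤ Algebra.adjoin k ((B : Set K) ∪ {u}))
    (U : ↥(Algebra.adjoin k ((B : Set K) ∪ {u}))) (hU : (U : K) = u)
    {A : Type} [CommRing A] [Algebra k A] (α : ↥B →ₐ[k] A) (x : A) :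
    ∃ ψ : ↥(Algebra.adjoin k ((B : Set K) ∪ {u})) →ₐ[k] A,
      (∀ b, ψ (Subalgebra.inclusion hle b) = α b) ∧ ψ U = x := by
  obtain ⟨e, heC, heX⟩ := adjArc_exists_algEquiv B u hu hle U hU
  refine ⟨(Polynomial.aevalTower α x).comp
    (e.symm : ↥(Algebra.adjoin k ((B : Set K) ∪ {u})) →ₐ[k] Polynomial ↥B), fun b => ?_, ?_⟩
  · rw [AlgHom.comp_apply, AlgEquiv.coe_toAlgHom, ← heC, AlgEquiv.symm_apply_apply,
      Polynomial.aevalTower_C]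
  · rw [AlgHom.comp_apply, AlgEquiv.coe_toAlgHom, ← heX, AlgEquiv.symm_apply_apply,
      Polynomial.aevalTower_X]

/-- Determination: two `k`-algebra maps out of `B[u]` agreeing on `incl B` and on `U` agree. -/
theorem adjArc_algHom_ext (B : Subalgebra k K) (u : K)
    (hu : ∀ q : Polynomial ↥B, Polynomial.aeval u q = 0 → q = 0)
    (hle : B ≤ Algebra.adjoin k ((B : Set K) ∪ {u}))
    (U : ↥(Algebra.adjoin k ((B : Set K) ∪ {u}))) (hU : (U : K) = u)
    {A : Type} [CommRing A] [Algebra k A]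
    {ψ₁ ψ₂ : ↥(Algebra.adjoin k ((B : Set K) ∪ {u})) →ₐ[k] A}
    (hC : ∀ b, ψ₁ (Subalgebra.inclusion hle b) = ψ₂ (Subalgebra.inclusion hle b))
    (hX : ψ₁ U = ψ₂ U) : ψ₁ = ψ₂ := by
  obtain ⟨e, heC, heX⟩ := adjArc_exists_algEquiv B u hu hle U hU
  have h : ψ₁.toRingHom.comp (e : Polynomial ↥B →ₐ[k] _).toRingHom =
      ψ₂.toRingHom.comp (e : Polynomial ↥B →ₐ[k] _).toRingHom := by
    refine Polynomial.ringHom_ext (fun a => ?_) ?_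
    · simpa [heC] using hC a
    · simpa [heX] using hX
  apply AlgHom.ext
  intro z
  obtain ⟨q, rfl⟩ := e.surjective z
  simpa using RingHom.congr_fun h q

/-- Nonnegativity propagates: a `k`-algebra map `B[u] → k⟦t^ℚ⟧` of nonnegative order on `incl B`
and on `U` has nonnegative order everywhere. -/
theorem adjArc_orderTop_nonneg (B : Subalgebra k K) (u : K)
    (hu : ∀ q : Polynomial ↥B, Polynomial.aeval u q = 0 → q = 0)
    (hle : B ≤ Algebra.adjoin k ((B : Set K) ∪ {u}))
    (U : ↥(Algebra.adjoin k ((B : Set K) ∪ {u}))) (hU : (U : K) = u)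
    (ψ : ↥(Algebra.adjoin k ((B : Set K) ∪ {u})) →ₐ[k] HahnSeries ℚ k)
    (hB : ∀ b, 0 ≤ (ψ (Subalgebra.inclusion hle b)).orderTop) (hUnn : 0 ≤ (ψ U).orderTop)
    (z : ↥(Algebra.adjoin k ((B : Set K) ∪ {u}))) : 0 ≤ (ψ z).orderTop := by
  obtain ⟨e, heC, heX⟩ := adjArc_exists_algEquiv B u hu hle U hU
  obtain ⟨q, rfl⟩ := e.surjective z
  induction q using Polynomial.induction_on with
  | C a =>
    rw [heC]
    exact hB a
  | add p q hp hq =>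
    rw [map_add, map_add]
    exact (le_min hp hq).trans HahnSeries.min_orderTop_le_orderTop_add
  | monomial n a h =>
    rw [pow_succ, ← mul_assoc, map_mul, map_mul, heX]
    exact (add_nonneg h hUnn).trans HahnSeries.orderTop_add_le_mul

end AdjoinArcEquivHelpers

/-- **Arc bijection along `B ⊆ B[u]`, `u` an indeterminate** (stub `rtd_adjoin_arcEquiv` of crux
`RisoCentresResolve`, line `Sketch`): with `B' = adjoin k (B ∪ {u})` for `u` transcendental over
`B`, `m'` an ideal of `B'` contracting to `m` and containing `U - c₀`, and `B` finitely presented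
inside `m`, the arcs `B' →ₐ[k] k⟦t^ℚ⟧` centred at `m'` are in bijection with the pairs
(arc of `B` centred at `m`, series of positive order) via `α' ↦ (α' ∘ incl, α' (U - c₀))`. -/
theorem rtd_adjoin_arcEquiv : ∀ {k K : Type} [Field k] [Field K] [Algebra k K] (B : Subalgebra k K) (m : Ideal ↥B) (u : K) (c₀ : k), (∀ q : Polynomial ↥B, Polynomial.aeval u q = 0 → q = 0) → ∀ (hle : B ≤ Algebra.adjoin k ((B : Set K) ∪ {u})) (m' : Ideal ↥(Algebra.adjoin k ((B : Set K) ∪ {u}))) (U : ↥(Algebra.adjoin k ((B : Set K) ∪ {u}))), (U : K) = u → (∀ b : ↥B, Subalgebra.inclusion hle b ∈ m' ↔ b ∈ m) → U - algebraMap k ↥(Algebra.adjoin k ((B : Set K) ∪ {u})) c₀ ∈ m' → (∃ (n : ℕ) (g : Fin n → ↥B), (∀ i, g i ∈ m) ∧ Algebra.adjoin k (Set.range g) = ⊤) → ∃ E : {α' : ↥(Algebra.adjoin k ((B : Set K) ∪ {u})) →ₐ[k] HahnSeries ℚ k // ∀ x ∈ m', 0 < (α' x).orderTop} ≃ {α :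 ↥B →ₐ[k] HahnSeries ℚ k // ∀ x ∈ m, 0 < (α x).orderTop} × {s : HahnSeries ℚ k // 0 < s.orderTop}, ∀ α' : {α' : ↥(Algebra.adjoin k ((B : Set K) ∪ {u})) →ₐ[k] HahnSeries ℚ k // ∀ x ∈ m', 0 < (α' x).orderTop}, (E α').1.1 = α'.1.comp (Subalgebra.inclusion hle) ∧ (E α').2.1 = α'.1 (U - algebraMap k ↥(Algebra.adjoin k ((B : Set K) ∪ {u})) c₀) := by
  intro k K _ _ _ B m u c₀ hu hle m' U hU hm' hU' hpres
  obtain ⟨n, g, hg, hgen⟩ := hpres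
  -- free extension of `k`-algebra maps from `B` to `B' = B[u]`
  choose ext hextC hextX using
    fun (α : ↥B →ₐ[k] HahnSeries ℚ k) (x : HahnSeries ℚ k) => adjArc_exists_ext B u hu hle U hU α x
  have hC : ∀ a : k, algebraMap k (HahnSeries ℚ k) a = HahnSeries.C a := arcEquiv_algebraMap_eq_C
  have hC0 : 0 ≤ (HahnSeries.C c₀ : HahnSeries ℚ k).orderTop := by
    rw [← hC]
    exact sqdom_orderTop_algebraMap_nonneg c₀
  have hextU : ∀ α x, ext α x (U - algebraMap k _ c₀) = x - HahnSeries.C c₀ := fun α x => by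
    rw [map_sub, hextX, AlgHom.commutes, hC]
  -- arcs of `B` centred at `m` are nonnegative on `B` (presentation inside `m`)
  have hBnn : ∀ α : {α : ↥B →ₐ[k] HahnSeries ℚ k // ∀ x ∈ m, 0 < (α x).orderTop}, ∀ b,
      0 ≤ (α.1 b).orderTop :=
    fun α => sqdom_orderTop_nonneg g hgen α.1 fun j => (α.2 _ (hg j)).le
  -- the extension of `(α, σ)` with `U ↦ C c₀ + σ` is centred at `m'`
  have hcent : ∀ p : {α : ↥B →ₐ[k] HahnSeries ℚ k // ∀ x ∈ m, 0 < (α x).orderTop} ×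
      {s : HahnSeries ℚ k // 0 < s.orderTop},
      ∀ z ∈ m', 0 < (ext p.1.1 (HahnSeries.C c₀ + p.2.1) z).orderTop := by
    rintro ⟨α, σ⟩ z hz
    obtain ⟨b₀, z₁, hzeq⟩ := adjArc_decomp B u hu hle U hU c₀ z
    have hb₀ : b₀ ∈ m := by
      rw [← hm']
      have : Subalgebra.inclusion hle b₀ = z - (U - algebraMap k _ c₀) * z₁ := by
        rw [hzeq]
        ring
      rw [this]
      exact sub_mem hz (m'.mul_mem_right _ hU')
    have hnn : 0 ≤ (ext α.1 (HahnSeries.C c₀ + σ.1) z₁).orderTop := by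
      refine adjArc_orderTop_nonneg B u hu hle U hU _ (fun b => ?_) ?_ z₁
      · rw [hextC]
        exact hBnn α b
      · rw [hextX]
        exact (le_min hC0 σ.2.le).trans HahnSeries.min_orderTop_le_orderTop_add
    rw [hzeq, map_add, map_mul, hextC, hextU, add_sub_cancel_left]
    refine (lt_min (α.2 _ hb₀) ?_).trans_le HahnSeries.min_orderTop_le_orderTop_add
    exact (add_pos_of_pos_of_nonneg σ.2 hnn).trans_le HahnSeries.orderTop_add_le_mul
  refine ⟨⟨fun α' => (⟨α'.1.comp (Subalgebra.inclusion hle), fun x hx => α'.2 _ ((hm' x).2 hx)⟩,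
      ⟨α'.1 (U - algebraMap k _ c₀), α'.2 _ hU'⟩),
    fun p => ⟨ext p.1.1 (HahnSeries.C c₀ + p.2.1), hcent p⟩, fun α' => ?_, fun p => ?_⟩,
    fun α' => ⟨rfl, rfl⟩⟩
  · -- restriction after extension
    apply Subtype.ext
    refine adjArc_algHom_ext B u hu hle U hU (fun b => ?_) ?_
    · rw [hextC]
      rfl
    · rw [hextX]
      change HahnSeries.C c₀ + α'.1 (U - algebraMap k _ c₀) = α'.1 U
      rw [map_sub, AlgHom.commutes, hC]
      ring
  · -- extension after restriction
    obtain ⟨α, σ⟩ := p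
    refine Prod.ext (Subtype.ext (AlgHom.ext fun b => ?_)) (Subtype.ext ?_)
    · exact hextC _ _ b
    · change ext α.1 (HahnSeries.C c₀ + σ.1) (U - algebraMap k _ c₀) = σ.1
      rw [hextU, add_sub_cancel_left]

end Summit.ResolutionOfSingularities.ResolutionOfSingularities.Theorems
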